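import Summits.QuantumFields.BalabanUV.Beta.FP.NestedStepLawTorusCompositeGen
import Summits.QuantumFields.BalabanUV.Beta.FP.TorusCompositeSliceOneShot
import Summits.QuantumFields.BalabanUV.Beta.FP.NestedFPSplit
import Literature.MathematicalPhysics.QuantumFieldTheory.Balaban1983to89.Beta.GaugeFixingPropagators

/-!
# `BalabanUV.Beta.FP.NestedStepLawTorusCompositeOneShot` — road «FP» for binder row D1, ROUTE T, memo §27 ∕ RULING R-FP-55 (α) (journal
# [D1P3-G20-RFP55], on leaf-06 g21's located question F-d1leaf06g21-1): **THE (j, m ≥ 2) TORUS CALL WITH THE FINE SYSTEM SLICED BY ITS OWN ONE-SHOT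
# BIG COMB** — OWNER #19, the reshaped #15 ∕ #17: `hτ₁ : τ₁ = bigP Lc (fine Lc M′) (rs ∘ succ) _ n`; (INV-m) ∧ (EFF-m) for this slice DISCHARGED inside
# by leaf-05's nested induction CARRIED ACROSS THE SLICE CHANGE by an2's Literature `GaugeFixingPropagators.blocks_sliceChange₃ ∕ isUnit_det_kkt_sliceChange₃`
# (three-block linearised Faddeev–Popov dictionary, [folklore]); the whole (SLICE-m) side, the generator side, and the order-0 rows DISCHARGED; NO hypothesis
# on the fine direction `h` (the nested Faddeev–Popov 2-jet vanishes by leaf-06 g21's SPLIT with the fine block automatic)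

WHY THE RESHAPE (R-FP-55).  (R1) The END's socket `StepDefectInherit.stepDefect_inherit` wants ONE function `Tj` on both sides of
`hfin : Tj j (m+1) = Rj j m + Tj j m + Dj j m`; under R-FP-54′ the door's left side is the ONE-SHOT literal `kkt H₀ [𝔔₀; P]` (`P = bigP … (n+1)`), so the
right side's fine term must be the one-shot `m`-fold literal too: `kkt H₀ [Q₁₀; bigP … n]` — which IS the depth-`n` door's left side over the top `fine Lc M′`
(`compRows_succ`, `rfl`).  (R2) The door treats `τ₁` as STATIC; `bigP`'s rows are field-independent point evaluations, the nested slice's inner blocks are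
composite averagings (field-dependent) whose jets a static `τ₁` would drop (leaf-06's hand witness).  (R3) The cost is ALREADY IN THE TREE: an2's
`GaugeFixingPropagators` §3c «SLICE CHANGE, three blocks» — `isUnit_det_kkt_sliceChange₃` (INV) and `blocks_sliceChange₃` (`effForm K [Q;P] = fromBlocks
(effForm K [Q;τ]).toBlocks₁₁ 0 0 0` — the `μμ` corner of the effective form DOES NOT SEE THE SLICE), from `H₀·W = 0`, `H₀ᵀ·W = 0`, `Q₁₀·W = 0` (the right blocks
of `a0` at `Y₀ = 0` and of `c0`) and the two transversalities `det (nestedSlice·W) ≠ 0` (leaf-06 g21 `TorusCompositeSlice`), `det (bigP·W) ≠ 0` (leaf-06 g20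
`TorusCompositeUnimodular`), `W :=` the lower tower generators.  (The OWNER's draft #18 `EffFormSliceIndependence` re-proved exactly this and is WITHDRAWN —
`dedup.landed` at dry-run; nothing filed.)

WHAT.  §1 `sum_perZ_bhKStepAt_ff_mul_towerGen ∕ torus_a0_tower`: (WARD-m) ORDER 0 at every depth — the finest form kills every column of leaf-06's tower
generator matrix (induction over `towerGen_succ`; base and top block by leaf-02 g16's `PeriodisedWardOrderZero` pairing lemmas, stated there for a GENERAL
torus).  §2 `secondVar_oneShot_nestedStepLaw_torus_composite_graded_oneShot`: #17's signature (`NestedStepLawTorusCompositeGen`) with the `hτ₁` pin replaced,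
`Y₀` erased and `a0` DISCHARGED (§1; graded `a1 a2` at `Y₀ = 0` — the shape leaf-02's `…RowsGraded` feeds; a free `Y₀` would make the `μμ` corner
slice-dependent), `Dbar := σ_{n+1} • D̄` PINNED and `c0 d0` DISCHARGED (leaf-02 g21 `TorusCompositeCovariance`), the (SLICE-m) binders `hTW s1 s2 t1 t2` REMOVED (supplied inside by leaf-06 g21's `torus_hTW_oneShot_tower`,
`torus_t1∕t2_tower_of_c1∕c2`, and the nested FP 2-jet `uT` by `NestedFPSplit.secondVar_nestedFP_eq_zero_of_t_uLow` with the fine block `uLow` AUTOMATIC —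
`torus_uLow_oneShot_tower`) in favour of ONE primitive deadness clause `hDb₁ hDb₂` (the composite insertion jets' coarse images vanish on the top comb — the
(B) `hdead` shape); NO hypothesis on the fine direction `h`.  At `n = 0` every object is #12's.  CONCLUSION VERBATIM #15's ∕ #17's.  [folklore] composition BY NAME; no `def`, no `def … : Prop`,
nothing cited, 0 sorry.  Nothing of the dictionary asserted; #15 ∕ #17 untouched (append-only; they remain correct theorems for the nested slice).

HONEST DEPENDENCY (page 1, mandatory): continuum YM on T⁴ ⇐ BetaPertH ∧ nine spine estimates (0/9 proved); BetaPertH ⇐ (D1) ∧ (D4) ∧ CAP+tail;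
G-an2-4 gates asym, D1 and NE2/3/4.  HONEST FRAMING (cell contract, verbatim): «discharging `BetaPertH` makes Bałaban's UV stability UNCONDITIONAL —
a real constructive-QFT result; it is NOT the continuum limit and NOT the Clay problem.»  ABSOLUTE RULE (cell charter, verbatim): «No internally-minted
statement may enter as a cited fact. Every hypothesis is either kernel-proved in this package or a verbatim quotation of a PUBLISHED theorem with page
reference. The manuscript(s) under audit are NOT citable for their own disputed steps — they are the thing under adjudication; programme-internal
(2001/route/tribunal) claims are never citable.»  0 estimates; 0∕4 row-D1 binders; NOT (T-ID), NOT SDF, NOT D1, NOT BetaPertH, NOT continuum, NOT Clay.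
Road «FP» OWNER, b2b-balaban-beta-d1-p3 gen 20, 2026-08-22.  No existing file touched.
-/

noncomputable section

namespace Summit.QuantumFields.BalabanUV.Beta.FP.NestedStepLawTorusCompositeOneShot

open Matrix
open Literature.MathematicalPhysics.QuantumFieldTheory.Balaban1983to89
open Literature.MathematicalPhysics.QuantumFieldTheory.Balaban1983to89.Beta
open Literature.MathematicalPhysics.QuantumFieldTheory.Balaban1983to89.Beta.Composition (kkt)
open Literature.MathematicalPhysics.QuantumFieldTheory.Balaban1983to89.Beta.CompositionSingular (effForm flucCov minOp minOpL)
open B5Prop11Plancherel (fine)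
open B6Lemma24Torus (pbox mem_pbox)
open AffineAveraging (Site box toSite)
open OneStepResolventKernel (Fib)
open Summit.QuantumFields.BalabanUV.Beta.BorderedHessian (bhKStepAt)
open Summit.QuantumFields.BalabanUV.Beta.AxialDressingRooted (IsCombBondAt)
open Summit.QuantumFields.BalabanUV.Beta.D1BFx.LogDetSecondVariation (secondVar)
open Summit.QuantumFields.BalabanUV.Beta.FP.KernelPeriodisationFib (Idx perF perF_apply perZ perZ_apply trF perF_transpose)
open Summit.QuantumFields.BalabanUV.Beta.FP.TorusCombRows (Res)
open Summit.QuantumFields.BalabanUV.Beta.FP.CompositeWardLetters (compWard_b0 compWard_b1 compWard_b2)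
open Summit.QuantumFields.BalabanUV.Beta.FP.NestedStepLawTransported (secondVar_nestedFP_eq_zero)
open Summit.QuantumFields.BalabanUV.Beta.FP.NestedStepLawTransportedExpGraded (secondVar_oneShot_nestedStepLaw_expTransported_graded_of_uni)
open Summit.QuantumFields.BalabanUV.Beta.FP.TorusCompositeObjects (towerTorus towerTorus_apply compRows nestedSlice NParam Qstep combF bigP towerGen
  towerGen_succ bigRoot bigRatio bigRatio_pos bigRatio_eq_pow pboxCongr pboxCongr_coe)
open Summit.QuantumFields.BalabanUV.Beta.FP.TorusCompositeUnimodular (det_bigP_mul_towerGen_ne_zero)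
open Summit.QuantumFields.BalabanUV.Beta.FP.TorusCompositeFP (evalN torus_uP_exp_tower)
open Summit.QuantumFields.BalabanUV.Beta.FP.TorusCompositeIntertwining (towerC₁ torus_j1_tower torus_j2_tower)
open Summit.QuantumFields.BalabanUV.Beta.FP.TorusGeneratorIntertwining (torus_uC_exp)
open Summit.QuantumFields.BalabanUV.Beta.FP.TorusGaugeCovariance (tgrad)
open Summit.QuantumFields.BalabanUV.Beta.FP.NestedStepLawTorusComposite (H₀_transpose_of_dvd dvd_towerTorus_succ)
open Summit.QuantumFields.BalabanUV.Beta.GAN24.FineReadoutCauchyFrame (toSite_mem_range)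
open AffineAveraging (unitVec)
open Summit.QuantumFields.BalabanUV.Beta.FP.TorusEffFormComposite (torus_composite_inv_and_eff)
open Summit.QuantumFields.BalabanUV.Beta.FP.RelInvPeriodisedCoarse (det_kkt_smul_form_ne_zero_iff)
open Summit.QuantumFields.BalabanUV.Beta.FP.RelInvPeriodisedCombRows (torus_isUnit_det_kkt_combRows)
open Summit.QuantumFields.BalabanUV.Beta.FP.RelInvPeriodisedEffFormCoarse (wVH_pos)
open Summit.QuantumFields.BalabanUV.Beta.FP.NestedStepLawTorusInstance (dvd_fine)
open Summit.QuantumFields.BalabanUV.Beta.FP.TorusCompositeSlice (det_nestedSlice_mul_towerGen_ne_zero torus_t1_tower_of_c1 torus_t2_tower_of_c2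
  det_combF_mul_smul_tgrad_res_ne_zero prod_stepScale_mul_card_ne_zero)
open Summit.QuantumFields.BalabanUV.Beta.FP.NestedFPSplit (secondVar_nestedFP_eq_zero_of_t_uLow)
open Summit.QuantumFields.BalabanUV.Beta.FP.TorusCompositeCovariance (compRows_mul_towerGen_succ Qtop_mul_smul_tgrad_res)
open Summit.QuantumFields.BalabanUV.Beta.FP.PeriodisedWardOrderZero (sum_perZ_bhKStepAt_ff_mul_tgrad sum_perZ_bhKStepAt_ff_mul_grad_periodic abs_tdelta_le)
open Summit.QuantumFields.BalabanUV.Beta.FP.TorusGaugeCovariance (tdelta)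
open Summit.QuantumFields.BalabanUV.Beta.FP.TorusGaugeCovarianceCoarse (tgradBlock tgradBlock_inl tdelta_quo_congr)
open Summit.QuantumFields.BalabanUV.Beta.BorderedHessian (stepScale)
open Literature.MathematicalPhysics.QuantumFieldTheory.LatticeForm (quo)
open Literature.MathematicalPhysics.QuantumFieldTheory.Balaban1983to89.B4TorusKernel.MultiPeriod (translate_apply)
open Summit.QuantumFields.BalabanUV.Beta.FP.TorusCompositeSliceOneShot (torus_hTW_oneShot_tower torus_uLow_oneShot_tower)
open Literature.MathematicalPhysics.QuantumFieldTheory.Balaban1983to89.Beta.GaugeFixingPropagators (isUnit_det_kkt_sliceChange₃ blocks_sliceChange₃)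
open Literature.Probability.LatticeModels (Torus.proj)
open BalabanStepJetsSucc (wVH)
open Finset

variable {d : ℕ}

/-! ## §1 (WARD-m) ORDER 0 AT EVERY DEPTH: the finest form kills every tower gauge mode -/

section WardZero

variable (Lc : ℕ) [NeZero Lc] {r : Fin (d + 1) → ℕ}

/-- [folklore] **`H₀ · W₀ = 0` FOR THE WHOLE TOWER, ENTRYWISE** — the level-`j` step form periodised on the finest torus `towerTorus Lc M n` kills every column
of leaf-06's tower generator matrix `towerGen Lc M rs n`: at depth `0` the columns are the torus's own gradients (`PeriodisedWardOrderZero.sum_perZ_bhKStepAt_ff_mul_tgrad`,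
stated there for a GENERAL torus); at depth `n+1` (`towerGen_succ`, `rfl`) the lower block is the induction hypothesis at the top `fine Lc M` (SAME finest torus:
`towerTorus Lc M (n+1)` IS `towerTorus Lc (fine Lc M) n`) and the top block's columns are gradients of the `Mℤ^{d+1}`-periodic bounded potentials
`z ↦ [quo (Lc^{n+1}) z ≡ t]` (`tgradBlock_inl`, `pboxCongr_coe` is `rfl`), killed by `sum_perZ_bhKStepAt_ff_mul_grad_periodic`.  Every root `r ∈ box Lc`, every level `j`. -/
theorem sum_perZ_bhKStepAt_ff_mul_towerGen (hr : r ∈ box (d + 1) Lc) (j : ℕ) :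
    ∀ (n : ℕ) (M : Fin (d + 1) → ℕ) [∀ μ, NeZero (M μ)] (rs : ℕ → (Fin (d + 1) → ℕ)) (x : Site (d + 1)) (κ : Fin (d + 1))
      (e : NParam Lc M rs n),
      ∑ y : ↥(pbox (towerTorus Lc M n)), ∑ l : Fin (d + 1),
        perZ (towerTorus Lc M n) (bhKStepAt d (toSite r) Lc j) x (y : Site (d + 1)) (Sum.inl κ) (Sum.inl l) * towerGen Lc M rs n (y, l) e = 0
  | 0, M, _, rs, x, κ, e => sum_perZ_bhKStepAt_ff_mul_tgrad M hr j x κ e.1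
  | n + 1, M, _, rs, x, κ, Sum.inr e => sum_perZ_bhKStepAt_ff_mul_towerGen hr j n (fine Lc M) (fun k => rs (k + 1)) x κ e
  | n + 1, M, _, rs, x, κ, Sum.inl t => by
    haveI : NeZero (bigRatio Lc n) := ⟨(bigRatio_pos Lc (Nat.pos_of_ne_zero (NeZero.ne Lc)) n).ne'⟩
    refine sum_perZ_bhKStepAt_ff_mul_grad_periodic (towerTorus Lc M (n + 1)) hr j x κ
      (φ := fun z : Site (d + 1) => tdelta M (quo (bigRatio Lc n) z) t.1) (fun z m => ?_) (fun z => abs_tdelta_le M _ t.1)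
    refine tdelta_quo_congr M (bigRatio Lc n) (fun i => ⟨m i, ?_⟩) t.1
    rw [translate_apply, towerTorus_apply, bigRatio_eq_pow]
    push_cast
    ring

/-- [folklore] **(WARD-m) `a0` OF THE COMPOSITE CALL, BINDERS VERBATIM**: with the call's `hH₀` (finest form, level `lev (n+1)`, root `rs (n+1)`) and `hW₀ : W₀ =
towerGen Lc M′ rs (n+1)`, `H₀ * W₀ = 0` (`Y₀ = 0`: the record's shape, as leaf-02's `torus_a0_letter` at depth 1). -/
theorem torus_a0_tower (M' : Fin (d + 1) → ℕ) [∀ μ, NeZero (M' μ)] (lev : ℕ → ℕ) (rs : ℕ → (Fin (d + 1) → ℕ)) (n : ℕ)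
    (hrs : ∀ k, rs k ∈ box (d + 1) Lc)
    {H₀ : Matrix (↥(pbox (towerTorus Lc M' (n + 1))) × Fin (d + 1)) (↥(pbox (towerTorus Lc M' (n + 1))) × Fin (d + 1)) ℝ}
    (hH₀ : H₀ = (perF (towerTorus Lc M' (n + 1)) (bhKStepAt d (toSite (rs (n + 1))) Lc (lev (n + 1)))).submatrix
        (fun b : ↥(pbox (towerTorus Lc M' (n + 1))) × Fin (d + 1) => ((b.1, Sum.inl b.2) : Idx (towerTorus Lc M' (n + 1)) (Fib d)))
        (fun b : ↥(pbox (towerTorus Lc M' (n + 1))) × Fin (d + 1) => ((b.1, Sum.inl b.2) : Idx (towerTorus Lc M' (n + 1)) (Fib d))))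
    {W₀ : Matrix (↥(pbox (towerTorus Lc M' (n + 1))) × Fin (d + 1)) (NParam Lc M' rs (n + 1)) ℝ} (hW₀ : W₀ = towerGen Lc M' rs (n + 1)) :
    H₀ * W₀ = 0 := by
  subst hH₀ hW₀
  ext p e
  rw [Matrix.mul_apply, Fintype.sum_prod_type, Matrix.zero_apply]
  simp only [Matrix.submatrix_apply, perF_apply]
  exact sum_perZ_bhKStepAt_ff_mul_towerGen Lc (hrs (n + 1)) (lev (n + 1)) (n + 1) M' rs (p.1 : Site (d + 1)) p.2 e

end WardZero

/-! ## §2 The call -/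

section CompositeOneShot

variable (M' : Fin (d + 1) → ℕ) [∀ μ, NeZero (M' μ)] (Lc : ℕ) [NeZero Lc] (lev : ℕ → ℕ) (rs : ℕ → (Fin (d + 1) → ℕ)) (n : ℕ)

set_option synthInstance.maxSize 1024 in
/-- [folklore] **THE (j, m ≥ 2) TORUS CALL WITH THE FINE SYSTEM SLICED BY ITS OWN ONE-SHOT BIG COMB (R-FP-55 (α)), GENERATOR SIDE AND SLICE SIDE
DISCHARGED.**  #17's `…_composite_graded_gen` with (i) `hτ₁ : τ₁ = bigP Lc (fine Lc M′) (rs ∘ succ) _ n` — the `(n+1)`-fold composite's one-shot comb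
of ratio `Lc^{n+1}` on the finest torus (EQUAL to the nested slice at `n = 0`: `bigP_zero = combF = nestedSlice_zero`), so that the right-hand side's fine
term IS the depth-`n` one-shot literal — the END's `Tj j m` on both sides of `hfin`; (ii) the (WARD-m) rows at `Y₀ := 0`; (iii) (INV-m) ∧ (EFF-m) for THIS
slice inside: leaf-05's nested `torus_composite_inv_and_eff` carried across the slice change by an2's Literature `GaugeFixingPropagators.isUnit_det_kkt_sliceChange₃ ∕
blocks_sliceChange₃` (inputs: the right blocks of `a0` and `c0`, leaf-06's `det_nestedSlice_mul_towerGen_ne_zero` and `det_bigP_mul_towerGen_ne_zero`); (iv) (SLICE-m) entirely inside (`hPW uP' hTW uT` by leaf-06's theorems — `uT` through the SPLIT, fine block automatic, coarse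
block from `t1 t2` over `c1 c2 hDb₁ hDb₂`; displayed instead ONE deadness clause `hDb₁ hDb₂`); (v) `j1 j2 uC` inside as in #17; (vi) `a0 c0 d0` inside.  DISPLAYED after this file:
(COV-m) `c1 c2 d1 d2` (leaf-02, orders 1–2), (T-β-1) `k1 k2 q1 q2`, (WARD-m) `a1 a2`, parities `hH₁t hH₂t`, namings, `hlev`, `hDb₁ hDb₂`.
CONCLUSION VERBATIM #15's∕#17's. -/
theorem secondVar_oneShot_nestedStepLaw_torus_composite_graded_oneShot (hrs : ∀ k, rs k ∈ box (d + 1) Lc) (hlev : ∀ i, lev i = lev (i + 1) + 1)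
    (hM' : ∀ i, Lc ∣ M' i)
    -- the coarse multipliers' slot presentation one level above `M′` (as (B): injective, `inr`-valued, exactly the `Lc`-coarse sites of `M′`)
    {κ : Type*} [Fintype κ] [DecidableEq κ] (pμ' : κ → ↥(pbox M')) (mμ' : κ → Fin (d + 1))
    (hfμ' : Function.Injective (fun a : κ => ((pμ' a, Sum.inr (mμ' a)) : Idx M' (Fib d))))
    (hcoarse' : ∀ (s : ↥(pbox M')) (m : Fin (d + 1)),
      ((s, Sum.inr m) : Idx M' (Fib d)) ∈ Set.range (fun a : κ => ((pμ' a, Sum.inr (mμ' a)) : Idx M' (Fib d))) ↔ Torus.proj Lc (s : Site (d + 1)) = 0)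
    -- the composite objects of record, PINNED by defining equations (leaf-06 `TorusCompositeObjects`)
    {H₀ : Matrix (↥(pbox (towerTorus Lc M' (n + 1))) × Fin (d + 1)) (↥(pbox (towerTorus Lc M' (n + 1))) × Fin (d + 1)) ℝ}
    {Q₁₀ : Matrix (↥(pbox M') × Fin (d + 1)) (↥(pbox (towerTorus Lc M' (n + 1))) × Fin (d + 1)) ℝ}
    {τ₁ : Matrix (NParam Lc (fine Lc M') (fun k => rs (k + 1)) n) (↥(pbox (towerTorus Lc M' (n + 1))) × Fin (d + 1)) ℝ}
    (hH₀ : H₀ = (perF (towerTorus Lc M' (n + 1)) (bhKStepAt d (toSite (rs (n + 1))) Lc (lev (n + 1)))).submatrix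
        (fun b : ↥(pbox (towerTorus Lc M' (n + 1))) × Fin (d + 1) => ((b.1, Sum.inl b.2) : Idx (towerTorus Lc M' (n + 1)) (Fib d)))
        (fun b : ↥(pbox (towerTorus Lc M' (n + 1))) × Fin (d + 1) => ((b.1, Sum.inl b.2) : Idx (towerTorus Lc M' (n + 1)) (Fib d))))
    (hQ₁₀ : Q₁₀ = compRows Lc M' lev rs (n + 1))
    -- R-FP-55 (α): the fine slice is the ONE-SHOT big comb of the tower below (leaf-06 `bigP`), NOT the nested slice
    (hτ₁ : τ₁ = bigP Lc (fine Lc M') (fun k => rs (k + 1)) (fun k => toSite_mem_range (hrs (k + 1))) n)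
    {τ₂ : Matrix (Res (toSite (rs 0)) Lc M') (↥(pbox M') × Fin (d + 1)) ℝ} (hτ₂ : τ₂ = combF Lc M' (rs 0))
    -- the top step's averaging rows (level `lev 0`, root `rs 0`), PINNED as (B)'s `hQ₂₀`
    {Q₂₀ : Matrix κ (↥(pbox M') × Fin (d + 1)) ℝ}
    (hQ₂₀ : Q₂₀ = (perF M' (bhKStepAt d (toSite (rs 0)) Lc (lev 0))).submatrix (fun a : κ => ((pμ' a, Sum.inr (mμ' a)) : Idx M' (Fib d)))
        (fun b : ↥(pbox M') × Fin (d + 1) => ((b.1, Sum.inl b.2) : Idx M' (Fib d))))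
    -- the tower's generators and the one-shot big comb: FREE matrices of the tower's types in v1 (pinned to leaf-06's `towerGen ∕ bigP` by the (SLICE-m) ∕
    -- (COV-m) suppliers in v1.1; target shape 36f428fe4d8b64c2)
    {W₀ : Matrix (↥(pbox (towerTorus Lc M' (n + 1))) × Fin (d + 1)) (NParam Lc M' rs (n + 1)) ℝ} (hW₀ : W₀ = towerGen Lc M' rs (n + 1))
    {P : Matrix (NParam Lc M' rs (n + 1)) (↥(pbox (towerTorus Lc M' (n + 1))) × Fin (d + 1)) ℝ} (hP : P = bigP Lc M' rs (fun k => toSite_mem_range (hrs k)) (n + 1))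
    -- the displayed jets: form (finest level), composite averaging, the top step's averaging jets, generators, witnesses, composite covariance images
    (H₁ H₂ : Matrix (↥(pbox (towerTorus Lc M' (n + 1))) × Fin (d + 1)) (↥(pbox (towerTorus Lc M' (n + 1))) × Fin (d + 1)) ℝ)
    (Q₁₁ Q₁₂ : Matrix (↥(pbox M') × Fin (d + 1)) (↥(pbox (towerTorus Lc M' (n + 1))) × Fin (d + 1)) ℝ)
    (Q₂₁ Q₂₂ : Matrix κ (↥(pbox M') × Fin (d + 1)) ℝ)
    -- the finest-level transport generator `X = −c·diag(λ)`, the tower's generator jets `W₁ W₂` (weight `h`) and the one-shot generator jets `W′₁ W′₂`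
    -- (weight `h + Dλ`) PINNED to the exponential closed forms of leaf-06's `TorusCompositeIntertwining` ∕ `TorusCompositeFP` (parameters `λ`, `c`, `h`)
    (lam : ↥(pbox (towerTorus Lc M' (n + 1))) → ℝ) (c : ℝ) (h : (↥(pbox (towerTorus Lc M' (n + 1))) × Fin (d + 1)) → ℝ)
    {W₁ W₂ : Matrix (↥(pbox (towerTorus Lc M' (n + 1))) × Fin (d + 1)) (NParam Lc M' rs (n + 1)) ℝ}
    (hW₁ : W₁ = Matrix.of fun (b : (↥(pbox (towerTorus Lc M' (n + 1))) × Fin (d + 1))) (e : NParam Lc M' rs (n + 1)) => -(c * h b * evalN Lc M' rs (n + 1) (fun b' : (↥(pbox (towerTorus Lc M' (n + 1))) × Fin (d + 1)) => (b'.1 : Site (d + 1)) + unitVec b'.2) b e))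
    (hW₂ : W₂ = Matrix.of fun (b : (↥(pbox (towerTorus Lc M' (n + 1))) × Fin (d + 1))) (e : NParam Lc M' rs (n + 1)) => (c * h b) ^ 2 * evalN Lc M' rs (n + 1) (fun b' : (↥(pbox (towerTorus Lc M' (n + 1))) × Fin (d + 1)) => (b'.1 : Site (d + 1)) + unitVec b'.2) b e)
    -- (COV-m) ORDER 0 PINNED (leaf-02 g21 `TorusCompositeCovariance`): `Dbar := σ_{n+1} • D̄`; the orders 1, 2 images stay displayed
    {Dbar : Matrix (↥(pbox M') × Fin (d + 1)) (Res (toSite (rs 0)) Lc M') ℝ}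
    (hDbar : Dbar = (∏ i ∈ range (n + 1), (stepScale d Lc (lev (i + 1)) * ((box (d + 1) Lc).card : ℝ))) •
        (tgrad M').submatrix (fun a : ↥(pbox M') × Fin (d + 1) => ((a.1, Sum.inl a.2) : Idx M' (Fib d))) (fun t : Res (toSite (rs 0)) Lc M' => (t.1 : ↥(pbox M'))))
    (Db₁ Db₂ : Matrix (↥(pbox M') × Fin (d + 1)) (Res (toSite (rs 0)) Lc M') ℝ)
    (Y₁ Y₂ : Matrix κ (NParam Lc M' rs (n + 1)) ℝ)
    -- the chart transport (exponential currency): generators `X` (finest fields), `X̄` (coarse multipliers); one-shot chart's generator jets; parameter-transport jets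
    {X : Matrix (↥(pbox (towerTorus Lc M' (n + 1))) × Fin (d + 1)) (↥(pbox (towerTorus Lc M' (n + 1))) × Fin (d + 1)) ℝ} (hX : X = -(c • Matrix.diagonal (fun b : (↥(pbox (towerTorus Lc M' (n + 1))) × Fin (d + 1)) => lam b.1))) (Xbar : Matrix κ κ ℝ)
    {W'₁ W'₂ : Matrix (↥(pbox (towerTorus Lc M' (n + 1))) × Fin (d + 1)) (NParam Lc M' rs (n + 1)) ℝ}
    (hW'₁ : W'₁ = Matrix.of fun (b : (↥(pbox (towerTorus Lc M' (n + 1))) × Fin (d + 1))) (e : NParam Lc M' rs (n + 1)) =>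
        -(c * (h b + ∑ s, tgrad (towerTorus Lc M' (n + 1)) (b.1, Sum.inl b.2) s * lam s) * evalN Lc M' rs (n + 1) (fun b' : (↥(pbox (towerTorus Lc M' (n + 1))) × Fin (d + 1)) => (b'.1 : Site (d + 1)) + unitVec b'.2) b e))
    (hW'₂ : W'₂ = Matrix.of fun (b : (↥(pbox (towerTorus Lc M' (n + 1))) × Fin (d + 1))) (e : NParam Lc M' rs (n + 1)) =>
        (c * (h b + ∑ s, tgrad (towerTorus Lc M' (n + 1)) (b.1, Sum.inl b.2) s * lam s)) ^ 2 * evalN Lc M' rs (n + 1) (fun b' : (↥(pbox (towerTorus Lc M' (n + 1))) × Fin (d + 1)) => (b'.1 : Site (d + 1)) + unitVec b'.2) b e)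
    {C₁ C₂ : Matrix (NParam Lc M' rs (n + 1)) (NParam Lc M' rs (n + 1)) ℝ} (hC₁ : C₁ = c • towerC₁ Lc M' rs (fun k => toSite_mem_range (hrs k)) (n + 1) lam) (hC₂ : C₂ = C₁ * C₁)
    {𝔔₀ 𝔔₁ 𝔔₂ : Matrix κ (↥(pbox (towerTorus Lc M' (n + 1))) × Fin (d + 1)) ℝ}
    (h𝔔₀ : Q₂₀ * Q₁₀ = 𝔔₀) (h𝔔₁ : Q₂₁ * Q₁₀ + Q₂₀ * Q₁₁ = 𝔔₁) (h𝔔₂ : Q₂₂ * Q₁₀ + Q₂₁ * Q₁₁ + (Q₂₁ * Q₁₁ + Q₂₀ * Q₁₂) = 𝔔₂)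
    -- (T-β-m) GRADED: the one-shot literal's composite jets are the graded `X`-conjugated words, NAMED
    {H'₁ H'₂ : Matrix (↥(pbox (towerTorus Lc M' (n + 1))) × Fin (d + 1)) (↥(pbox (towerTorus Lc M' (n + 1))) × Fin (d + 1)) ℝ}
    {𝔔'₁ 𝔔'₂ : Matrix κ (↥(pbox (towerTorus Lc M' (n + 1))) × Fin (d + 1)) ℝ}
    (k1 : -(Xᵀ * H₀) + H₁ + H₀ * X = H'₁)
    (k2 : (X * X)ᵀ * H₀ + (-(Xᵀ * H₁) + -(Xᵀ * H₀ * X)) + ((-(Xᵀ * H₁) + -(Xᵀ * H₀ * X)) + (H₂ + H₁ * X + (H₁ * X + H₀ * (X * X)))) = H'₂)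
    (q1 : Xbar * 𝔔₀ + 𝔔₁ + 𝔔₀ * X = 𝔔'₁)
    (q2 : Xbar * Xbar * 𝔔₀ + (Xbar * 𝔔₁ + Xbar * 𝔔₀ * X) + ((Xbar * 𝔔₁ + Xbar * 𝔔₀ * X) + (𝔔₂ + 𝔔₁ * X + (𝔔₁ * X + 𝔔₀ * (X * X)))) = 𝔔'₂)
    -- (T-β-4) `j1 j2 uC` DISCHARGED (leaf-06 `TorusCompositeIntertwining.torus_j1_tower ∕ torus_j2_tower`, `TorusGeneratorIntertwining.torus_uC_exp`)
    -- (INV-m) `h1` and (EFF-m) `h2` are DISCHARGED inside: leaf-05 `torus_composite_inv_and_eff` for the NESTED slice, transferred to the one-shot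
    -- slice by an2's Literature `GaugeFixingPropagators.isUnit_det_kkt_sliceChange₃ ∕ blocks_sliceChange₃` (R-FP-55 (R3))
    {Γ : Matrix (↥(pbox (towerTorus Lc M' (n + 1))) × Fin (d + 1)) (↥(pbox (towerTorus Lc M' (n + 1))) × Fin (d + 1)) ℝ}
    {I : Matrix (↥(pbox (towerTorus Lc M' (n + 1))) × Fin (d + 1)) ((↥(pbox M') × Fin (d + 1)) ⊕ NParam Lc (fine Lc M') (fun k => rs (k + 1)) n) ℝ}
    {L : Matrix ((↥(pbox M') × Fin (d + 1)) ⊕ NParam Lc (fine Lc M') (fun k => rs (k + 1)) n) (↥(pbox (towerTorus Lc M' (n + 1))) × Fin (d + 1)) ℝ}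
    {S : Matrix ((↥(pbox M') × Fin (d + 1)) ⊕ NParam Lc (fine Lc M') (fun k => rs (k + 1)) n)
      ((↥(pbox M') × Fin (d + 1)) ⊕ NParam Lc (fine Lc M') (fun k => rs (k + 1)) n) ℝ}
    {B : Matrix ((↥(pbox M') × Fin (d + 1)) ⊕ NParam Lc (fine Lc M') (fun k => rs (k + 1)) n) (↥(pbox (towerTorus Lc M' (n + 1))) × Fin (d + 1)) ℝ}
    (hΓ : flucCov H₀ (fromRows Q₁₀ τ₁) = Γ) (hI : minOp H₀ (fromRows Q₁₀ τ₁) = I) (hL : minOpL H₀ (fromRows Q₁₀ τ₁) = L) (hS : effForm H₀ (fromRows Q₁₀ τ₁) = S)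
    (hB : fromRows Q₁₁ (0 : Matrix (NParam Lc (fine Lc M') (fun k => rs (k + 1)) n) (↥(pbox (towerTorus Lc M' (n + 1))) × Fin (d + 1)) ℝ) = B)
    -- (SLICE-m) ALL DISCHARGED: `hPW uP'` (leaf-06 g20), `hTW` (leaf-06 g21 `TorusCompositeSliceOneShot`), the nested Faddeev–Popov 2-jet `uT`
    -- by leaf-06 g21's SPLIT `NestedFPSplit.secondVar_nestedFP_eq_zero_of_t_uLow` (block lower-triangular under `c0 c1 c2`; fine block `uLow`
    -- AUTOMATIC — `torus_uLow_oneShot_tower`, exponential jets on the one-shot comb one level down, NO deadness of the direction; coarse block from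
    -- `t1 t2` = `TorusCompositeSlice` §2 over `c1 c2` + `hDb₁ hDb₂`); DISPLAYED instead of `hTW s1 s2 t1 t2`: ONLY «the composite insertion jets' coarse
    -- images are DEAD on the top comb» (the (B) `hdead` shape) — no hypothesis on the fine direction `h` at all
    (hDb₁ : ∀ a : ↥(pbox M') × Fin (d + 1), IsCombBondAt (toSite (rs 0)) Lc a.2 (a.1 : Site (d + 1)) → Db₁ a = 0)
    (hDb₂ : ∀ a : ↥(pbox M') × Fin (d + 1), IsCombBondAt (toSite (rs 0)) Lc a.2 (a.1 : Site (d + 1)) → Db₂ a = 0)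
    -- parities of the displayed form jets; the GRADED Ward rows of the finest form against the composite witnesses (NO transposed rows)
    (hH₁t : H₁ᵀ = -H₁) (hH₂t : H₂ᵀ = H₂)
    -- (WARD-m) ORDER 0 `a0 : H₀ * W₀ = 0` DISCHARGED (§1 `torus_a0_tower`, `Y₀ = 0`); orders 1, 2 at `Y₀ := 0`, displayed
    (a1 : H₁ * W₀ + H₀ * W₁ = 𝔔₀ᵀ * Y₁)
    (a2 : H₂ * W₀ + (2 : ℝ) • (H₁ * W₁) + H₀ * W₂ = -((2 : ℝ) • (𝔔₁ᵀ * Y₁)) + 𝔔₀ᵀ * Y₂)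
    -- (COV-m) ORDERS 1, 2 displayed (`c0 ∕ d0` DISCHARGED: leaf-02 g21 `compRows_mul_towerGen_succ` ∕ `Qtop_mul_smul_tgrad_res`)
    (c1 : Q₁₁ * W₀ + Q₁₀ * W₁ = fromCols Db₁ (0 : Matrix (↥(pbox M') × Fin (d + 1)) (NParam Lc (fine Lc M') (fun k => rs (k + 1)) n) ℝ))
    (c2 : Q₁₂ * W₀ + (2 : ℝ) • (Q₁₁ * W₁) + Q₁₀ * W₂ = fromCols Db₂ (0 : Matrix (↥(pbox M') × Fin (d + 1)) (NParam Lc (fine Lc M') (fun k => rs (k + 1)) n) ℝ))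
    (d1 : Q₂₁ * Dbar + Q₂₀ * Db₁ = 0) (d2 : Q₂₂ * Dbar + (2 : ℝ) • (Q₂₁ * Db₁) + Q₂₀ * Db₂ = 0) :
    secondVar (kkt H₀ (fromRows 𝔔₀ P))
        (fromBlocks H'₁ (-(fromRows 𝔔'₁ (0 : Matrix (NParam Lc M' rs (n + 1)) (↥(pbox (towerTorus Lc M' (n + 1))) × Fin (d + 1)) ℝ))ᵀ)
          (fromRows 𝔔'₁ (0 : Matrix (NParam Lc M' rs (n + 1)) (↥(pbox (towerTorus Lc M' (n + 1))) × Fin (d + 1)) ℝ)) 0)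
        (kkt H'₂ (fromRows 𝔔'₂ (0 : Matrix (NParam Lc M' rs (n + 1)) (↥(pbox (towerTorus Lc M' (n + 1))) × Fin (d + 1)) ℝ)))
      = secondVar (kkt H₀ (fromRows Q₁₀ τ₁)) (fromBlocks H₁ (-Bᵀ) B 0)
            (kkt H₂ (fromRows Q₁₂ (0 : Matrix (NParam Lc (fine Lc M') (fun k => rs (k + 1)) n) (↥(pbox (towerTorus Lc M' (n + 1))) × Fin (d + 1)) ℝ)))
        + secondVar
            (kkt S.toBlocks₁₁ (fromRows Q₂₀ τ₂))
            (fromBlocks ((L * H₁ - S * B) * I + L * Bᵀ * S).toBlocks₁₁ (-(fromRows Q₂₁ (0 : Matrix (Res (toSite (rs 0)) Lc M') (↥(pbox M') × Fin (d + 1)) ℝ))ᵀ)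
              (fromRows Q₂₁ (0 : Matrix (Res (toSite (rs 0)) Lc M') (↥(pbox M') × Fin (d + 1)) ℝ)) 0)
            (kkt (((-((L * H₁ - S * B) * Γ - L * Bᵀ * L) * H₁ + L * H₂
                      - (((L * H₁ - S * B) * I + L * Bᵀ * S) * B
                          + S * fromRows Q₁₂ (0 : Matrix (NParam Lc (fine Lc M') (fun k => rs (k + 1)) n) (↥(pbox (towerTorus Lc M' (n + 1))) × Fin (d + 1)) ℝ))) * I
                    + (L * H₁ - S * B) * (-((Γ * H₁ + I * B) * I + Γ * Bᵀ * S)))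
                  - ((-((L * H₁ - S * B) * Γ - L * Bᵀ * L) * (-Bᵀ)
                        + L * (fromRows Q₁₂ (0 : Matrix (NParam Lc (fine Lc M') (fun k => rs (k + 1)) n) (↥(pbox (towerTorus Lc M' (n + 1))) × Fin (d + 1)) ℝ))ᵀ) * S
                      + L * (-Bᵀ) * ((L * H₁ - S * B) * I + L * Bᵀ * S))).toBlocks₁₁
              (fromRows Q₂₂ (0 : Matrix (Res (toSite (rs 0)) Lc M') (↥(pbox M') × Fin (d + 1)) ℝ))) := by
  have hL0 : 0 < Lc := Nat.pos_of_ne_zero (NeZero.ne Lc)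
  -- (WARD-m) order 0 (§1) and (COV-m) order 0 (leaf-02 g21) BY TERM
  have a0 : H₀ * W₀ = 0 := torus_a0_tower Lc M' lev rs n hrs hH₀ hW₀
  have c0 : Q₁₀ * W₀ = fromCols Dbar (0 : Matrix (↥(pbox M') × Fin (d + 1)) (NParam Lc (fine Lc M') (fun k => rs (k + 1)) n) ℝ) := by
    rw [hQ₁₀, hW₀, hDbar]; exact compRows_mul_towerGen_succ Lc n M' lev rs hrs
  have d0 : Q₂₀ * Dbar = 0 := by
    rw [hQ₂₀, hDbar]; exact Qtop_mul_smul_tgrad_res Lc M' (hrs 0) hM' (lev 0) _ pμ' mμ'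
  -- `H₀ᵀ = H₀` at the finest level of the tower; leaf-05's nested (INV) ∧ (EFF)
  have hH₀t : H₀ᵀ = H₀ := H₀_transpose_of_dvd (dvd_towerTorus_succ (Lc := Lc) M' n) (lev (n + 1)) hH₀
  have hIE := torus_composite_inv_and_eff Lc n M' lev rs hlev hrs
  -- the NESTED slice and the LOWER tower generators of the tower below `M′`, NAMED at the call's index types (the spellings
  -- `towerTorus Lc M′ (n+1)` ∕ `towerTorus Lc (fine Lc M′) n` are defeq only at default transparency — located, g19)
  obtain ⟨τn, hτn⟩ : ∃ τn : Matrix (NParam Lc (fine Lc M') (fun k => rs (k + 1)) n) (↥(pbox (towerTorus Lc M' (n + 1))) × Fin (d + 1)) ℝ,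
      τn = nestedSlice Lc (fine Lc M') (fun k => lev (k + 1)) (fun k => rs (k + 1)) n := ⟨_, rfl⟩
  obtain ⟨Wl, hWl⟩ : ∃ Wl : Matrix (↥(pbox (towerTorus Lc M' (n + 1))) × Fin (d + 1)) (NParam Lc (fine Lc M') (fun k => rs (k + 1)) n) ℝ,
      Wl = towerGen Lc (fine Lc M') (fun k => rs (k + 1)) n := ⟨_, rfl⟩
  -- `W₀ = fromCols D_top Wl` (`towerGen_succ`, `rfl`): the lower generators are the right column block of `W₀`
  have hW2 : W₀.toCols₂ = Wl := by
    rw [hWl, hW₀]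
    exact Matrix.toCols₂_fromCols _ _
  -- killed by `H₀` (right block of `a0`) and by `Q₁₀` (right block of `c0`)
  have hKW : H₀ * Wl = 0 := by
    have h0 : H₀ * Matrix.fromCols W₀.toCols₁ W₀.toCols₂ = 0 := by rw [Matrix.fromCols_toCols]; exact a0
    rw [Matrix.mul_fromCols, ← Matrix.fromCols_zero] at h0
    rw [← hW2]
    exact (Matrix.fromCols_inj h0).2
  have hKtW : H₀ᵀ * Wl = 0 := by rw [hH₀t]; exact hKW
  have hQW : Q₁₀ * Wl = 0 := by
    have h0 : Q₁₀ * Matrix.fromCols W₀.toCols₁ W₀.toCols₂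
        = Matrix.fromCols Dbar (0 : Matrix (↥(pbox M') × Fin (d + 1)) (NParam Lc (fine Lc M') (fun k => rs (k + 1)) n) ℝ) := by
      rw [Matrix.fromCols_toCols]; exact c0
    rw [Matrix.mul_fromCols] at h0
    rw [← hW2]
    exact (Matrix.fromCols_inj h0).2
  -- transversal to both slices (leaf-06 g21 ∕ g20)
  have hT : (τn * Wl).det ≠ 0 := by
    rw [hτn, hWl]
    exact det_nestedSlice_mul_towerGen_ne_zero Lc n (fine Lc M') (fun k => lev (k + 1)) (fun k => rs (k + 1)) (fun k => hrs (k + 1)) (dvd_fine M')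
  have hSW : (τ₁ * Wl).det ≠ 0 := by
    rw [hτ₁, hWl]
    exact det_bigP_mul_towerGen_ne_zero Lc (fine Lc M') (fun k => rs (k + 1)) (fun k => toSite_mem_range (hrs (k + 1))) (dvd_fine M') n
  -- leaf-05's nested (INV)
  have hτn1 : (kkt H₀ (fromRows Q₁₀ τn)).det ≠ 0 := by
    rw [hH₀, hQ₁₀, hτn]; exact hIE.1
  -- (INV) ∧ (EFF) ACROSS THE SLICE CHANGE (an2's Literature `GaugeFixingPropagators` §3c, three blocks)
  have h1 : (kkt H₀ (fromRows Q₁₀ τ₁)).det ≠ 0 :=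
    (isUnit_det_kkt_sliceChange₃ H₀ Q₁₀ τn τ₁ Wl hKW hKtW hQW (isUnit_iff_ne_zero.2 hT) (isUnit_iff_ne_zero.2 hSW)
      (isUnit_iff_ne_zero.2 hτn1)).ne_zero
  have hEff : (effForm H₀ (fromRows Q₁₀ τ₁)).toBlocks₁₁ = (effForm H₀ (fromRows Q₁₀ τn)).toBlocks₁₁ := by
    rw [(blocks_sliceChange₃ H₀ Q₁₀ τn τ₁ Wl hKW hKtW hQW (isUnit_iff_ne_zero.2 hT) (isUnit_iff_ne_zero.2 hSW)
      (isUnit_iff_ne_zero.2 hτn1)).2.2.2, toBlocks_fromBlocks₁₁]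
  have hc : (∏ i ∈ range (n + 1), (wVH d Lc (lev i))⁻¹) ≠ 0 :=
    prod_ne_zero_iff.mpr fun i _ => inv_ne_zero (wVH_pos hL0 (lev i)).ne'
  have h2 : (kkt S.toBlocks₁₁ (fromRows Q₂₀ τ₂)).det ≠ 0 := by
    rw [← hS, hEff, hH₀, hQ₁₀, hτn, hIE.2 (rs 0), hQ₂₀, hτ₂, det_kkt_smul_form_ne_zero_iff hc]
    exact (torus_isUnit_det_kkt_combRows M' (hrs 0) hM' (lev 0) _ hfμ' (fun a => ⟨mμ' a, rfl⟩) hcoarse').ne_zero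
  -- the composite constraint rows from the covariance rows
  have b0 := compWard_b0 Q₁₀ Q₂₀ W₀ Dbar c0 d0 h𝔔₀
  have b1 := compWard_b1 Q₁₀ Q₁₁ Q₂₀ Q₂₁ W₀ W₁ Dbar Db₁ c0 c1 d1 h𝔔₀ h𝔔₁
  have b2 := compWard_b2 Q₁₀ Q₁₁ Q₁₂ Q₂₀ Q₂₁ Q₂₂ W₀ W₁ W₂ Dbar Db₁ Db₂ c0 c1 c2 d2 h𝔔₀ h𝔔₁ h𝔔₂
  -- (SLICE-m) letters for the ONE-SHOT fine slice (leaf-06 g21) and the coarse dead rows from `c1 c2` (leaf-06 g21)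
  have hTW := torus_hTW_oneShot_tower M' Lc lev rs n hrs hM' hQ₁₀ hτ₁ hτ₂ hW₀
  have t1 := torus_t1_tower_of_c1 M' Lc (hrs 0) hM' hτ₂ Q₁₀ Q₁₁ W₀ W₁ Db₁ c1 hDb₁
  have t2 := torus_t2_tower_of_c2 M' Lc (hrs 0) hM' hτ₂ Q₁₀ Q₁₁ Q₁₂ W₀ W₁ W₂ Db₂ c2 hDb₂
  -- the nested FP 2-jet `uT` by leaf-06's SPLIT: top block from `t1 t2`, fine block AUTOMATIC (exponential jets on the one-shot comb one level down)
  have hup : (τ₂ * Dbar).det ≠ 0 := by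
    rw [hτ₂, hDbar]; exact det_combF_mul_smul_tgrad_res_ne_zero Lc M' (hrs 0) hM' (prod_stepScale_mul_card_ne_zero (d := d) Lc lev (n + 1))
  have hlow : (τ₁ * W₀.toCols₂).det ≠ 0 := by rw [hW2]; exact hSW
  have uLow := torus_uLow_oneShot_tower M' Lc rs n hrs c h hτ₁ hW₀ hW₁ hW₂
  have uT := secondVar_nestedFP_eq_zero_of_t_uLow τ₁ τ₂ Q₁₀ Q₁₁ Q₁₂ W₀ W₁ W₂ Dbar Db₁ Db₂ c0 c1 c2 hup hlow t1 t2 uLow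
  -- the GRADED transported law (exponential currency; colour lift inside) with `G = 0`, every (T-β-4) ∕ (SLICE-m) letter supplied BY NAME
  have hlaw := secondVar_oneShot_nestedStepLaw_expTransported_graded_of_uni H₀ H₁ H₂ Q₁₀ Q₁₁ Q₁₂ Q₂₀ Q₂₁ Q₂₂ 0 0 0 τ₁ τ₂ P W₀ W₁ W₂
    0 Y₁ Y₂ X Xbar W'₁ W'₂ C₁ C₂
    (show H₀ + Q₁₀ᵀ * (0 : Matrix (↥(pbox M') × Fin (d + 1)) (↥(pbox M') × Fin (d + 1)) ℝ) * Q₁₀ = H₀ by rw [Matrix.mul_zero, Matrix.zero_mul, add_zero])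
    (show H₁ + (-(Q₁₁ᵀ * (0 : Matrix (↥(pbox M') × Fin (d + 1)) (↥(pbox M') × Fin (d + 1)) ℝ) * Q₁₀)
        + Q₁₀ᵀ * (0 : Matrix (↥(pbox M') × Fin (d + 1)) (↥(pbox M') × Fin (d + 1)) ℝ) * Q₁₀
        + Q₁₀ᵀ * (0 : Matrix (↥(pbox M') × Fin (d + 1)) (↥(pbox M') × Fin (d + 1)) ℝ) * Q₁₁) = H₁ by simp only [Matrix.mul_zero, Matrix.zero_mul, neg_zero, add_zero])
    (show H₂ + ((Q₁₂ᵀ * (0 : Matrix (↥(pbox M') × Fin (d + 1)) (↥(pbox M') × Fin (d + 1)) ℝ) * Q₁₀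
          + -(Q₁₁ᵀ * (0 : Matrix (↥(pbox M') × Fin (d + 1)) (↥(pbox M') × Fin (d + 1)) ℝ) * Q₁₀)
          + -(Q₁₁ᵀ * (0 : Matrix (↥(pbox M') × Fin (d + 1)) (↥(pbox M') × Fin (d + 1)) ℝ) * Q₁₁))
        + (-(Q₁₁ᵀ * (0 : Matrix (↥(pbox M') × Fin (d + 1)) (↥(pbox M') × Fin (d + 1)) ℝ) * Q₁₀)
          + Q₁₀ᵀ * (0 : Matrix (↥(pbox M') × Fin (d + 1)) (↥(pbox M') × Fin (d + 1)) ℝ) * Q₁₀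
          + Q₁₀ᵀ * (0 : Matrix (↥(pbox M') × Fin (d + 1)) (↥(pbox M') × Fin (d + 1)) ℝ) * Q₁₁)
        + (-(Q₁₁ᵀ * (0 : Matrix (↥(pbox M') × Fin (d + 1)) (↥(pbox M') × Fin (d + 1)) ℝ) * Q₁₁)
          + Q₁₀ᵀ * (0 : Matrix (↥(pbox M') × Fin (d + 1)) (↥(pbox M') × Fin (d + 1)) ℝ) * Q₁₁
          + Q₁₀ᵀ * (0 : Matrix (↥(pbox M') × Fin (d + 1)) (↥(pbox M') × Fin (d + 1)) ℝ) * Q₁₂)) = H₂ by simp only [Matrix.mul_zero, Matrix.zero_mul, neg_zero, add_zero])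
    h𝔔₀ h𝔔₁ h𝔔₂ k1 k2 q1 q2
    (by rw [hW₀, hC₁]; exact torus_j1_tower Lc M' rs _ (n + 1) lam c h hX hW₁ hW'₁)
    (by rw [hW₀, hC₂, hC₁]; exact torus_j2_tower Lc M' rs _ (n + 1) lam c h hX hW₁ hW'₁ hW₂ hW'₂)
    (by rw [hC₂, hC₁]; exact torus_uC_exp c _)
    (by rw [hP, hW₀, hW'₁, hW'₂]
        exact torus_uP_exp_tower Lc M' rs _ hM' (n + 1) c
          (fun b : (↥(pbox (towerTorus Lc M' (n + 1))) × Fin (d + 1)) => (h b + ∑ s, tgrad (towerTorus Lc M' (n + 1)) (b.1, Sum.inl b.2) s * lam s)) rfl rfl)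
    uT
    hH₀t hH₁t hH₂t (by rw [Matrix.mul_zero]; exact a0) (by rw [Matrix.mul_zero, neg_zero, zero_add]; exact a1)
    (by rw [Matrix.mul_zero, zero_add]; exact a2) b0 b1 b2
    (by rw [hP, hW₀]; exact det_bigP_mul_towerGen_ne_zero Lc M' rs _ hM' (n + 1)) hTW hΓ hI hL hS hB h1 (by rw [add_zero]; exact h2)
  simp only [add_zero] at hlaw
  exact hlaw

end CompositeOneShot

end Summit.QuantumFields.BalabanUV.Beta.FP.NestedStepLawTorusCompositeOneShot

end
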